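import Mathlib

/-!
# Crux `MatrixDescartes` (stmt-ValiantsHypothesis-18050), line `Lift` — registered stub `stub_reverse`

The REVERSAL `X ↦ 1/X` of a lacunary matrix pencil.  For a pencil
`p := det (X^e • J + ∑ₖ X^{dₖ} • Pₖ)` (real square matrices `J`, `Pₖ` over a finite index type `ι`)
and a common bound `N ≥ e, dₖ`, the REFLECTED pencil is
`p♯ := det (X^{N-e} • J + ∑ₖ X^{N-dₖ} • Pₖ)`.  Then `p` and `p♯` have the same number of distinct
positive roots (`StubReverse.card_posRoots_reflect_le`, applied twice, and `stub_reverse`).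

Proof (pointwise, no polynomial-reversal API):
* `det` commutes with the evaluation ring homomorphism, so
  `p.eval t = det (t^e • J + ∑ₖ t^{dₖ} • Pₖ)` (`StubReverse.eval_det_pencil`);
* for `t ≠ 0`, `t^{N-e} • J + ∑ₖ t^{N-dₖ} • Pₖ = t^N • ((t⁻¹)^e • J + ∑ₖ (t⁻¹)^{dₖ} • Pₖ)`, hence
  `p♯.eval t = t^{N·card ι} · p.eval t⁻¹` (`StubReverse.eval_det_reflect`);
* so for `t > 0`, `t` is a root of `p♯` iff `t⁻¹` is a root of `p`; if `p = 0` then `p♯` vanishes on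
  `(0, ∞)` and is `0` too; otherwise `t ↦ t⁻¹` injects the positive roots of `p♯` into those of `p`
  (`StubReverse.card_posRoots_reflect_le`); the reflection of the reflection is the original pencil
  (`N - (N - e) = e`), so the inequality holds both ways.

Elementary; Mathlib only (axioms `propext`, `Classical.choice`, `Quot.sound`).
-/

-- layout Summits/ValiantsHypothesis/ValiantsHypothesis forces the duplicated namespace component
set_option linter.dupNamespace false

namespace Summit.ValiantsHypothesis.ValiantsHypothesis.Theorems.LacunarySymmetroidMatrixDescartes

open Polynomial Matrix Finset
open scoped BigOperators

namespace StubReverse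

variable {ι κ : Type} [Fintype ι] [DecidableEq ι] [Fintype κ]

/-- Evaluating the determinant of the polynomial pencil `X^e • J + ∑ₖ X^{dₖ} • Pₖ` at a real point
`t` gives the determinant of the real matrix `t^e • J + ∑ₖ t^{dₖ} • Pₖ` (`det` commutes with the
evaluation ring homomorphism). -/
theorem eval_det_pencil (e : ℕ) (d : κ → ℕ) (J : Matrix ι ι ℝ) (P : κ → Matrix ι ι ℝ) (t : ℝ) :
    (Matrix.det (((Polynomial.X : Polynomial ℝ) ^ e) • J.map Polynomial.C
        + ∑ k, ((Polynomial.X : Polynomial ℝ) ^ d k) • (P k).map Polynomial.C)).eval t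
      = Matrix.det (t ^ e • J + ∑ k, t ^ d k • P k) := by
  have h := RingHom.map_det (Polynomial.evalRingHom t)
    (((Polynomial.X : Polynomial ℝ) ^ e) • J.map Polynomial.C
        + ∑ k, ((Polynomial.X : Polynomial ℝ) ^ d k) • (P k).map Polynomial.C)
  rw [Polynomial.coe_evalRingHom] at h
  rw [h]
  congr 1
  ext i j
  simp only [RingHom.mapMatrix_apply, Matrix.map_apply, Matrix.add_apply, Matrix.smul_apply,
    Matrix.sum_apply, smul_eq_mul, Polynomial.coe_evalRingHom, Polynomial.eval_add,
    Polynomial.eval_mul, Polynomial.eval_pow, Polynomial.eval_X, Polynomial.eval_C,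
    Polynomial.eval_finsetSum]

omit [Fintype ι] [DecidableEq ι] in
/-- Pulling the scalar `t^N` out of the reflected real pencil (`t ≠ 0`, `e, dₖ ≤ N`):
`t^{N-e} • J + ∑ₖ t^{N-dₖ} • Pₖ = t^N • ((t⁻¹)^e • J + ∑ₖ (t⁻¹)^{dₖ} • Pₖ)`. -/
theorem reflect_eq_smul (e N : ℕ) (d : κ → ℕ) (J : Matrix ι ι ℝ) (P : κ → Matrix ι ι ℝ)
    (he : e ≤ N) (hd : ∀ k, d k ≤ N) {t : ℝ} (ht : t ≠ 0) :
    t ^ (N - e) • J + ∑ k, t ^ (N - d k) • P k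
      = t ^ N • ((t⁻¹) ^ e • J + ∑ k, (t⁻¹) ^ d k • P k) := by
  have key : ∀ m : ℕ, m ≤ N → t ^ N * (t⁻¹) ^ m = t ^ (N - m) := by
    intro m hm
    rw [inv_pow, pow_sub₀ _ ht hm]
  rw [smul_add, Finset.smul_sum, smul_smul, key e he]
  congr 1
  refine Finset.sum_congr rfl fun k _ => ?_
  rw [smul_smul, key (d k) (hd k)]

/-- The reflected pencil at `t ≠ 0` versus the original pencil at `t⁻¹`:
`p♯.eval t = t^{N·card ι} · p.eval t⁻¹`. -/
theorem eval_det_reflect (e N : ℕ) (d : κ → ℕ) (J : Matrix ι ι ℝ) (P : κ → Matrix ι ι ℝ)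
    (he : e ≤ N) (hd : ∀ k, d k ≤ N) {t : ℝ} (ht : t ≠ 0) :
    (Matrix.det (((Polynomial.X : Polynomial ℝ) ^ (N - e)) • J.map Polynomial.C
        + ∑ k, ((Polynomial.X : Polynomial ℝ) ^ (N - d k)) • (P k).map Polynomial.C)).eval t
      = t ^ (N * Fintype.card ι) *
        (Matrix.det (((Polynomial.X : Polynomial ℝ) ^ e) • J.map Polynomial.C
          + ∑ k, ((Polynomial.X : Polynomial ℝ) ^ d k) • (P k).map Polynomial.C)).eval t⁻¹ := by
  rw [eval_det_pencil, eval_det_pencil, reflect_eq_smul e N d J P he hd ht, Matrix.det_smul,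
    pow_mul]

/-- One direction of the reversal: the reflected pencil has at most as many distinct positive roots
as the original one (`t ↦ t⁻¹` injects the former into the latter; the zero polynomial is handled
separately: if `p = 0` then `p♯` vanishes on `(0, ∞)`, so `p♯ = 0`). -/
theorem card_posRoots_reflect_le (e N : ℕ) (d : κ → ℕ) (J : Matrix ι ι ℝ) (P : κ → Matrix ι ι ℝ)
    (he : e ≤ N) (hd : ∀ k, d k ≤ N) :
    ((Matrix.det (((Polynomial.X : Polynomial ℝ) ^ (N - e)) • J.map Polynomial.C
        + ∑ k, ((Polynomial.X : Polynomial ℝ) ^ (N - d k)) • (P k).map Polynomial.C)).roots.toFinset.filter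
          (fun t => 0 < t)).card
      ≤ ((Matrix.det (((Polynomial.X : Polynomial ℝ) ^ e) • J.map Polynomial.C
        + ∑ k, ((Polynomial.X : Polynomial ℝ) ^ d k) • (P k).map Polynomial.C)).roots.toFinset.filter
          (fun t => 0 < t)).card := by
  set p := Matrix.det (((Polynomial.X : Polynomial ℝ) ^ e) • J.map Polynomial.C
        + ∑ k, ((Polynomial.X : Polynomial ℝ) ^ d k) • (P k).map Polynomial.C) with hp_def
  set q := Matrix.det (((Polynomial.X : Polynomial ℝ) ^ (N - e)) • J.map Polynomial.C
        + ∑ k, ((Polynomial.X : Polynomial ℝ) ^ (N - d k)) • (P k).map Polynomial.C) with hq_def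
  -- root correspondence on `(0, ∞)`
  have hqp : ∀ t : ℝ, 0 < t → (q.IsRoot t ↔ p.IsRoot t⁻¹) := by
    intro t ht
    rw [Polynomial.IsRoot.def, Polynomial.IsRoot.def, hq_def, hp_def,
      eval_det_reflect e N d J P he hd ht.ne', mul_eq_zero, or_iff_right (pow_ne_zero _ ht.ne')]
  by_cases hp : p = 0
  · -- then `q` vanishes on the infinite set `(0, ∞)`, so `q = 0`
    have hq : q = 0 := by
      refine Polynomial.eq_zero_of_infinite_isRoot q ?_
      refine Set.Infinite.mono (fun t ht => ?_) (Set.Ioi_infinite (0 : ℝ))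
      have ht' : (0 : ℝ) < t := ht
      exact (hqp t ht').2 (by simp [hp])
    simp [hq]
  · refine Finset.card_le_card_of_injOn (fun t => t⁻¹) (fun t ht => ?_) ?_
    · have ht' := Finset.mem_coe.1 ht
      rw [Finset.mem_filter, Multiset.mem_toFinset, Polynomial.mem_roots'] at ht'
      obtain ⟨⟨-, hroot⟩, hpos⟩ := ht'
      rw [Finset.mem_coe, Finset.mem_filter, Multiset.mem_toFinset, Polynomial.mem_roots hp]
      exact ⟨(hqp t hpos).1 hroot, inv_pos.2 hpos⟩
    · intro a _ b _ hab
      exact inv_injective hab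

end StubReverse

/-- **Registered stub `stub_reverse`** (reversal `X ↦ 1/X`): the number of distinct positive zeros of
`det (X^e J + ∑ₖ X^{dₖ} Pₖ)` is unchanged when all exponents are reflected, `e ↦ N − e`,
`dₖ ↦ N − dₖ` (`N ≥ e, dₖ`): for `t > 0`, `det(reflected)(t) = t^{N·card ι} · det(original)(1/t)`.
No symmetry or definiteness is needed. -/
theorem stub_reverse (ι κ : Type) [Fintype ι] [DecidableEq ι] [Fintype κ] (e N : ℕ) (d : κ → ℕ)
    (J : Matrix ι ι ℝ) (P : κ → Matrix ι ι ℝ) (he : e ≤ N) (hd : ∀ k, d k ≤ N) :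
    ((Matrix.det (((Polynomial.X : Polynomial ℝ) ^ e) • J.map Polynomial.C
        + ∑ k, ((Polynomial.X : Polynomial ℝ) ^ d k) • (P k).map Polynomial.C)).roots.toFinset.filter
          (fun t => 0 < t)).card
      = ((Matrix.det (((Polynomial.X : Polynomial ℝ) ^ (N - e)) • J.map Polynomial.C
        + ∑ k, ((Polynomial.X : Polynomial ℝ) ^ (N - d k)) • (P k).map Polynomial.C)).roots.toFinset.filter
          (fun t => 0 < t)).card := by
  refine le_antisymm ?_ (StubReverse.card_posRoots_reflect_le e N d J P he hd)
  -- the reflection of the reflected pencil is the original pencil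
  have h := StubReverse.card_posRoots_reflect_le (ι := ι) (N - e) N (fun k => N - d k) J P
    (Nat.sub_le N e) (fun k => Nat.sub_le N (d k))
  have hd' : ∀ k, N - (N - d k) = d k := fun k => Nat.sub_sub_self (hd k)
  simp only [Nat.sub_sub_self he, hd'] at h
  exact h

end Summit.ValiantsHypothesis.ValiantsHypothesis.Theorems.LacunarySymmetroidMatrixDescartes
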